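import Summits.QuantumFields.YangMills.Theorems.LuscherReductionTwistedTraceScalingGaussianLinear
import Mathlib.MeasureTheory.Measure.Haar.InnerProductSpace
import Mathlib.MeasureTheory.Constructions.Pi
import HarnessLib

/-!
# The Gaussian integral in the product coordinates `w : ι → Fin 3 → ℝ` of the gnomonic gauge-group chart: currying is volume preserving, and
# `∫ exp(−b‖A w‖²) dw = (π/b)^{3|ι|/2} / normDet(A ∘ e)`
# (lane A of S-BASE, crux `TwistedTraceScaling` stmt-QuantumFields-20203, C4 INNER; design note `pub/ym-fleet/ym-luscher-20007-p1/COARSE-DESIGN.md` §23.9 (N2-d))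

`…GaugeGroupGnChart` / `…GaussianSandwich` write based gauge-group integrals in the flat coordinates `w : ι → Fin 3 → ℝ` with the product Lebesgue measure `volume`;
`…GaussianLinear` evaluates Gaussians on inner product spaces.  THIS FILE bridges the two:
* ★ `volume_preserving_uncurry` / `volume_preserving_curry` — `(ι × κ → ℝ) ≃ᵐ (ι → κ → ℝ)` preserves Lebesgue measure (absent from Mathlib; boxes + `Measure.pi_eq`);
* `euclToPi` — the measure-preserving linear identification `EuclideanSpace ℝ (ι × Fin 3) → (ι → Fin 3 → ℝ)` (★ `volume_preserving_euclToPi`);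
* ★★ `integral_exp_neg_mul_sq_norm_pi`: for a linear `A : (ι → Fin 3 → ℝ) → F` into a real inner product space with `A ∘ euclToPi` injective and `dim F = 3|ι|`:
  `∫ w, exp(−b‖A w‖²) ∂volume = (π/b)^{3|ι|/2} / normDet(A ∘ₗ euclToPiₗ)` — the Gram determinant taken w.r.t. the Euclidean structure of the flat coordinates.
HONEST FRAMING: textbook measure theory for a stub of a child of the CONDITIONAL reduction route R2b1; no spectral claim; C4 OPEN; not a gap, not Clay.
-/

set_option autoImplicit false

noncomputable section

open MeasureTheory Real Module

namespace Summit.QuantumFields.YangMills.Theorems.FemtoTransferGap.TwoLattice.ConstTube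

/-! ## §1 Currying is volume preserving -/

section Curry

variable (ι κ : Type*) [Fintype ι] [Fintype κ]

omit [Fintype ι] [Fintype κ] in
/-- The preimage of a box under uncurrying is an iterated box. [folklore] -/
theorem uncurry_preimage_pi (s : ι × κ → Set ℝ) :
    (MeasurableEquiv.curry ι κ ℝ).symm ⁻¹' Set.pi Set.univ s = Set.pi Set.univ fun i => Set.pi Set.univ fun k => s (i, k) := by
  ext g
  simp [MeasurableEquiv.coe_curry_symm, Function.uncurry, Set.mem_pi]

/-- ★ **Uncurrying `(ι → κ → ℝ) → (ι × κ → ℝ)` preserves Lebesgue measure.** [folklore] -/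
theorem volume_preserving_uncurry : MeasurePreserving (MeasurableEquiv.curry ι κ ℝ).symm (volume : Measure (ι → κ → ℝ)) (volume : Measure (ι × κ → ℝ)) := by
  refine ⟨(MeasurableEquiv.curry ι κ ℝ).symm.measurable, ?_⟩
  symm
  refine Measure.pi_eq fun s hs => ?_
  rw [Measure.map_apply (MeasurableEquiv.curry ι κ ℝ).symm.measurable (MeasurableSet.univ_pi hs), uncurry_preimage_pi,
    volume_pi, Measure.pi_pi]
  simp_rw [volume_pi, Measure.pi_pi]
  rw [← Finset.prod_product', Finset.univ_product_univ]

/-- ★ **Currying `(ι × κ → ℝ) → (ι → κ → ℝ)` preserves Lebesgue measure.** [folklore] -/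
theorem volume_preserving_curry : MeasurePreserving (MeasurableEquiv.curry ι κ ℝ) (volume : Measure (ι × κ → ℝ)) (volume : Measure (ι → κ → ℝ)) :=
  (volume_preserving_uncurry ι κ).symm _

end Curry

/-! ## §2 The Euclidean identification of the flat coordinates and the Gaussian -/

section Gauss

variable (ι : Type*) [Fintype ι]

/-- The linear identification `EuclideanSpace ℝ (ι × Fin 3) →ₗ (ι → Fin 3 → ℝ)` (curry ∘ ofLp). [folklore] -/
def euclToPiₗ : EuclideanSpace ℝ (ι × Fin 3) →ₗ[ℝ] (ι → Fin 3 → ℝ) where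
  toFun v := fun i a => v (i, a)
  map_add' v w := by funext i a; rfl
  map_smul' c v := by funext i a; rfl

omit [Fintype ι] in
/-- Its action. [folklore] -/
@[simp] theorem euclToPiₗ_apply (v : EuclideanSpace ℝ (ι × Fin 3)) (i : ι) (a : Fin 3) : euclToPiₗ ι v i a = v (i, a) := rfl

/-- The same identification as a measurable equivalence. [folklore] -/
def euclToPiM : EuclideanSpace ℝ (ι × Fin 3) ≃ᵐ (ι → Fin 3 → ℝ) :=
  (MeasurableEquiv.toLp 2 (ι × Fin 3 → ℝ)).symm.trans (MeasurableEquiv.curry ι (Fin 3) ℝ)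

omit [Fintype ι] in
/-- The two identifications agree. [folklore] -/
theorem coe_euclToPiM : ⇑(euclToPiM ι) = ⇑(euclToPiₗ ι) := rfl

/-- ★ The identification is volume preserving. [folklore] -/
theorem volume_preserving_euclToPiM : MeasurePreserving (euclToPiM ι) (volume : Measure (EuclideanSpace ℝ (ι × Fin 3))) (volume : Measure (ι → Fin 3 → ℝ)) :=
  (volume_preserving_curry ι (Fin 3)).comp (EuclideanSpace.volume_preserving_symm_measurableEquiv_toLp (ι × Fin 3))

/-- ★★ **THE GAUSSIAN IN FLAT PRODUCT COORDINATES**: for a linear `A : (ι → Fin 3 → ℝ) → F` with `A ∘ euclToPi` injective and `dim F = 3|ι|`,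
`∫ w, exp(−b‖A w‖²) = (π/b)^{(3|ι|)/2} / normDet(A ∘ₗ euclToPiₗ)`. [folklore] -/
theorem integral_exp_neg_mul_sq_norm_pi {F : Type*} [NormedAddCommGroup F] [InnerProductSpace ℝ F] [FiniteDimensional ℝ F]
    (A : (ι → Fin 3 → ℝ) →ₗ[ℝ] F) (hA : Function.Injective (A ∘ₗ euclToPiₗ ι)) (h : finrank ℝ F = finrank ℝ (EuclideanSpace ℝ (ι × Fin 3))) {b : ℝ} (hb : 0 < b) :
    ∫ w, Real.exp (-b * ‖A w‖ ^ 2) ∂(volume : Measure (ι → Fin 3 → ℝ)) =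
      (π / b) ^ (finrank ℝ (EuclideanSpace ℝ (ι × Fin 3)) / 2 : ℝ) / (A ∘ₗ euclToPiₗ ι).normDet := by
  rw [← (volume_preserving_euclToPiM ι).integral_comp' (fun w => Real.exp (-b * ‖A w‖ ^ 2))]
  exact integral_exp_neg_mul_sq_norm_comp_of_injective (A ∘ₗ euclToPiₗ ι) hA h hb

end Gauss

end Summit.QuantumFields.YangMills.Theorems.FemtoTransferGap.TwoLattice.ConstTube

end
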